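import Literature.MathematicalPhysics.QuantumLattice.BlochBogoliubovImplementer
import Literature.MathematicalPhysics.QuantumLattice.OnSitePairingTrace
import Literature.MathematicalPhysics.QuantumLattice.PatchPairOperator
import Literature.MathematicalPhysics.QuantumLattice.DWaveSource
import Literature.MathematicalPhysics.QuantumLattice.HubbardFreeCovariance
import HarnessLib

/-!
# The BdG (Bogoliubov–de Gennes) partition function of the `d`-wave-sourced free Hubbard torus

Topic `MathematicalPhysics/QuantumLattice`. For the `U = 0` Hubbard model on the torus `(ℤ/Lℤ)²`
(hopping `1`, chemical potential `μ`) with the uniform `d_{x²-y²}` pair source of strength `s`,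
`H_L(s) = dWaveSourceTorus L 0 μ s = H(1,0) - μN - s(Δ_d + Δ_d†)` (`DWaveSource.lean`), we PROVE
the closed formula for the grand-canonical partition function (`L ≥ 3`):

  `Tr e^{-β H_L(s)} = 2^{2L²} Π_{k ∈ (ℤ/Lℤ)²} e^{-βξ_k} (1 + cosh(β E_k(s)))/2`,
  `ξ_k = ε_L(k) - μ`, `E_k(s)² = ξ_k² + 8 s² ĝ_d(k)²`, `ĝ_d(k) = cos k₁ - cos k₂`

(`partitionFn_dWaveSourceTorus_zero`), i.e. `Z = Π_k (2 cosh(βE_k/2))² e^{-βξ_k}` — the textbook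
BCS/BdG mean-field partition function (Bardeen–Cooper–Schrieffer 1957 §III; de Gennes 1966
Ch. 4; von Delft–Ralph 2001 §4.2), here for the `d`-wave form factor and in finite volume, and the
resulting **sourced pressure gain of the free gas**
`log Z(s) - log Z(0) = Σ_k [log((1 + cosh βE_k(s))/2) - log((1 + cosh βξ_k)/2)]`
(`log_partitionFn_dWaveSourceTorus_zero_sub`).

## Proof

In momentum space `H_L(s) = Σ_{kσ} ξ_k n_{kσ} + 2√2 s Σ_k ĝ_d(k)(b_k + b_k†)`, `b_k = c_{-k↓}c_{k↑}`
(`hubbardTorusWith_zero_eq_sum_momentumNumber`, `pairField_dWave_eq_smul_pairOperator`). The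
Bogoliubov implementer `W` of the relabelling `(x,↑) ↦ (k_x,↑)`, `(x,↓) ↦ (-k_x,↓)`
(`exists_bogoliubov_implementer`, `BlochBogoliubovImplementer.lean`) conjugates the sum of ON-SITE
two-mode blocks `Σ_x [ξ_{k_x}(n_{x↑} + n_{x↓}) + 2√2 s ĝ_d(k_x)(c_{x↓}c_{x↑} + h.c.)]` into `H_L(s)`
(using `ε_L(-k) = ε_L(k)`), so the two have the same partition function, and the on-site trace
factorises (`trace_exp_neg_smul_sum_onSiteBdG`, `OnSitePairingTrace.lean`).

Everything is proved; no definition and no named fact.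

## References

* J. Bardeen, L. N. Cooper, J. R. Schrieffer, Phys. Rev. 108 (1957) 1175, §III.
* P. G. de Gennes, *Superconductivity of Metals and Alloys* (1966), Ch. 4–5. [deGennes1966]
* J. von Delft, D. C. Ralph, Phys. Rep. 345 (2001) 61, §4.2. [VondelftRalph2001]
* D. J. Scalapino, Phys. Rep. 250 (1995) 329, §2 (the `d_{x²-y²}` pair field). [Scalapino1995]
-/

noncomputable section

namespace Literature.MathematicalPhysics.QuantumLattice

open Matrix Finset Literature.Probability.LatticeModels
open scoped ComplexConjugate

variable {L : ℕ} [NeZero L]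

/-! ### The relabelling `(x,↑) ↦ (k_x,↑)`, `(x,↓) ↦ (-k_x,↓)` -/

/-- The twisted momentum relabelling of the orbitals is injective. [folklore] -/
theorem twistedLabel_injective :
    Function.Injective (fun o : Orb (FermionTorus 2 L) =>
      ((if (ofLex o).2 = 0 then (ofLex o).1.toTorusSite else -(ofLex o).1.toTorusSite), (ofLex o).2)) := by
  intro o o' h
  simp only [Prod.mk.injEq] at h
  obtain ⟨h1, h2⟩ := h
  have hinj : Function.Injective (FermionTorus.toTorusSite (d := 2) (L := L)) :=
    (FermionTorus.equivTorusSite (d := 2) (L := L)).injective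
  have hx : (ofLex o).1 = (ofLex o').1 := by
    by_cases hσ : (ofLex o).2 = 0
    · rw [if_pos hσ, if_pos (h2 ▸ hσ)] at h1
      exact hinj h1
    · rw [if_neg hσ, if_neg (h2 ▸ hσ)] at h1
      exact hinj (neg_injective h1)
  calc o = toLex (ofLex o) := (toLex_ofLex o).symm
    _ = toLex ((ofLex o).1, (ofLex o).2) := rfl
    _ = toLex ((ofLex o').1, (ofLex o').2) := by rw [hx, h2]
    _ = o' := toLex_ofLex o'

/-- **The Bogoliubov implementer of the BdG relabelling**: Fock-space matrices `W, W'` with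
`W'W = WW' = 1` and `W c_{x↑} W' = c_{k_x↑}`, `W c_{x↓} W' = c_{-k_x↓}`, `W c†_{x↑} W' = c†_{k_x↑}`,
`W c†_{x↓} W' = c†_{-k_x↓}` (`k_x` the momentum label with the same coordinates as the site `x`).
[cite: BratteliRobinsonII1997, §5.2.2 (Bogoliubov transformations implemented by Γ(U))] -/
theorem exists_bdg_implementer :
    ∃ W W' : Matrix (Finset (Orb (FermionTorus 2 L))) (Finset (Orb (FermionTorus 2 L))) ℂ,
      W' * W = 1 ∧ W * W' = 1 ∧
      (∀ x : FermionTorus 2 L, W * annihilation (orb x 0) * W' = momentumAnnihilation x.toTorusSite 0) ∧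
      (∀ x : FermionTorus 2 L, W * annihilation (orb x 1) * W' = momentumAnnihilation (-x.toTorusSite) 1) ∧
      (∀ x : FermionTorus 2 L, W * creation (orb x 0) * W' = momentumCreation x.toTorusSite 0) ∧
      (∀ x : FermionTorus 2 L, W * creation (orb x 1) * W' = momentumCreation (-x.toTorusSite) 1) := by
  obtain ⟨W, W', h1, h2, h3, h4⟩ := exists_bogoliubov_implementer _ (twistedLabel_injective (L := L))
  refine ⟨W, W', h1, h2, fun x => ?_, fun x => ?_, fun x => ?_, fun x => ?_⟩
  · simpa [orb] using h3 (orb x 0)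
  · simpa [orb] using h3 (orb x 1)
  · simpa [orb] using h4 (orb x 0)
  · simpa [orb] using h4 (orb x 1)

/-! ### The sourced free Hamiltonian in momentum space -/

/-- **`H_L(s)` in momentum space** (`L ≥ 3`):
`dWaveSourceTorus L 0 μ s = Σ_k [ξ_k (n_{k↑} + n_{k↓}) + 2√2 s ĝ_d(k) (b_k + b_k†)]`,
`ξ_k = ε_L(k) - μ`, `b_k = c_{-k↓} c_{k↑}`. [cite: Scalapino1995, §2] -/
theorem dWaveSourceTorus_zero_eq_sum (hL : 3 ≤ L) (μ s : ℝ) :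
    dWaveSourceTorus L 0 μ s = ∑ k : TorusSite 2 L,
      (((torusBand L k - μ : ℝ) : ℂ) • (momentumNumber k 0 + momentumNumber k 1) +
        ((2 * Real.sqrt 2 * s * dWaveGap k : ℝ) : ℂ) • (pairMode k + (pairMode k)ᴴ)) := by
  have hkin : hubbardTorusWith 2 L 1 0 μ =
      ∑ k : TorusSite 2 L, ((torusBand L k - μ : ℝ) : ℂ) • (momentumNumber k 0 + momentumNumber k 1) := by
    rw [hubbardTorusWith_zero_eq_sum_momentumNumber hL μ]
    refine Finset.sum_congr rfl fun k _ => ?_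
    rw [Fin.sum_univ_two, smul_add]
  have hsrc : pairField dWaveFormFactor L + (pairField dWaveFormFactor L)ᴴ =
      -(((2 * Real.sqrt 2 : ℝ) : ℂ) • ∑ k : TorusSite 2 L, (dWaveGap k : ℂ) • (pairMode k + (pairMode k)ᴴ)) := by
    rw [pairField_dWave_eq_smul_pairOperator, conjTranspose_neg, conjTranspose_smul, pairOperator_conjTranspose,
      pairOperator]
    have hstar : star ((2 * Real.sqrt 2 : ℝ) : ℂ) = ((2 * Real.sqrt 2 : ℝ) : ℂ) := Complex.conj_ofReal _
    rw [hstar, ← neg_add, ← smul_add, ← Finset.sum_add_distrib]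
    congr 2
    refine Finset.sum_congr rfl fun k _ => ?_
    rw [smul_add, pairMode_conjTranspose]
  have hcoef : ∀ k : TorusSite 2 L, (s : ℂ) * ((2 * Real.sqrt 2 : ℝ) : ℂ) * (dWaveGap k : ℂ) =
      ((2 * Real.sqrt 2 * s * dWaveGap k : ℝ) : ℂ) := by
    intro k
    push_cast
    ring
  rw [dWaveSourceTorus, hkin, hsrc, smul_neg, sub_neg_eq_add, Finset.smul_sum, Finset.smul_sum,
    ← Finset.sum_add_distrib]
  refine Finset.sum_congr rfl fun k _ => ?_
  rw [smul_smul, smul_smul, hcoef]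

/-! ### Conjugating the on-site blocks into `H_L(s)` -/

/-- Conjugation is linear: `W (Σ_x (a_x A_x + b_x B_x)) W' = Σ_x (a_x W A_x W' + b_x W B_x W')`. [folklore] -/
theorem conj_sum_smul_add_smul {n ι : Type*} [Fintype n] [Fintype ι] (W W' : Matrix n n ℂ)
    (a b : ι → ℂ) (A B : ι → Matrix n n ℂ) :
    W * (∑ x, (a x • A x + b x • B x)) * W' = ∑ x, (a x • (W * A x * W') + b x • (W * B x * W')) := by
  rw [Finset.mul_sum, Finset.sum_mul]
  refine Finset.sum_congr rfl fun x _ => ?_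
  rw [mul_add, add_mul, mul_smul_comm, smul_mul_assoc, mul_smul_comm, smul_mul_assoc]

/-- **The on-site BdG blocks are conjugate to the sourced free Hamiltonian** (`L ≥ 3`): with the
implementer of `exists_bdg_implementer`,
`W (Σ_x [ξ_{k_x}(n_{x↑}+n_{x↓}) + 2√2 s ĝ_d(k_x)(c_{x↓}c_{x↑} + h.c.)]) W' = dWaveSourceTorus L 0 μ s`.
[cite: deGennes1966, Ch. 5 (Bogoliubov transformation of the BdG Hamiltonian)] -/
theorem exists_conj_onSiteBdG_eq_dWaveSourceTorus (hL : 3 ≤ L) (μ s : ℝ) :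
    ∃ W W' : Matrix (Finset (Orb (FermionTorus 2 L))) (Finset (Orb (FermionTorus 2 L))) ℂ,
      W' * W = 1 ∧
      W * (∑ x : FermionTorus 2 L,
        (((torusBand L x.toTorusSite - μ : ℝ) : ℂ) • (numberOp x 0 + numberOp x 1) +
          ((2 * Real.sqrt 2 * s * dWaveGap x.toTorusSite : ℝ) : ℂ) •
            (annihilation (orb x 1) * annihilation (orb x 0) +
              (annihilation (orb x 1) * annihilation (orb x 0))ᴴ))) * W' =
      dWaveSourceTorus L 0 μ s := by
  obtain ⟨W, W', h1, _h2, ha0, ha1, hc0, hc1⟩ := exists_bdg_implementer (L := L)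
  refine ⟨W, W', h1, ?_⟩
  -- conjugate each on-site operator
  have hnum : ∀ (x : FermionTorus 2 L), W * (numberOp x 0 + numberOp x 1) * W' =
      momentumNumber x.toTorusSite 0 + momentumNumber (-x.toTorusSite) 1 := by
    intro x
    rw [mul_add, add_mul, numberOp, numberOp, conj_mul_of_mul_eq_one h1, conj_mul_of_mul_eq_one h1,
      hc0, ha0, hc1, ha1, momentumNumber, momentumNumber]
  have hpair : ∀ (x : FermionTorus 2 L),
      W * (annihilation (orb x 1) * annihilation (orb x 0) + (annihilation (orb x 1) * annihilation (orb x 0))ᴴ) * W' =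
      pairMode x.toTorusSite + (pairMode x.toTorusSite)ᴴ := by
    intro x
    rw [pairMode_conjTranspose, pairMode, mul_add, add_mul, conjTranspose_mul, annihilation_conjTranspose,
      annihilation_conjTranspose, conj_mul_of_mul_eq_one h1, conj_mul_of_mul_eq_one h1, ha1, ha0, hc0, hc1]
  have hsum : W * (∑ x : FermionTorus 2 L,
        (((torusBand L x.toTorusSite - μ : ℝ) : ℂ) • (numberOp x 0 + numberOp x 1) +
          ((2 * Real.sqrt 2 * s * dWaveGap x.toTorusSite : ℝ) : ℂ) •
            (annihilation (orb x 1) * annihilation (orb x 0) +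
              (annihilation (orb x 1) * annihilation (orb x 0))ᴴ))) * W' =
      ∑ x : FermionTorus 2 L,
        (((torusBand L x.toTorusSite - μ : ℝ) : ℂ) • (momentumNumber x.toTorusSite 0 + momentumNumber (-x.toTorusSite) 1) +
          ((2 * Real.sqrt 2 * s * dWaveGap x.toTorusSite : ℝ) : ℂ) • (pairMode x.toTorusSite + (pairMode x.toTorusSite)ᴴ)) := by
    rw [conj_sum_smul_add_smul]
    exact Finset.sum_congr rfl fun x _ => by rw [hnum, hpair]
  rw [hsum, dWaveSourceTorus_zero_eq_sum hL μ s]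
  -- reindex sites by momenta and use `ε_L(-k) = ε_L(k)` for the `↓` modes
  have hreidx : ∑ z : TorusSite 2 L, ((torusBand L z - μ : ℝ) : ℂ) • momentumNumber (-z) 1 =
      ∑ z : TorusSite 2 L, ((torusBand L z - μ : ℝ) : ℂ) • momentumNumber z 1 := by
    rw [← Equiv.sum_comp (Equiv.neg (TorusSite 2 L))]
    refine Finset.sum_congr rfl fun z _ => ?_
    simp only [Equiv.neg_apply, neg_neg, torusBand_neg]
  rw [FermionTorus.sum_eq_sum_torusSite]
  simp only [FermionTorus.toTorusSite_ofTorusSite, smul_add, Finset.sum_add_distrib, hreidx]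

/-! ### The partition function -/

omit [NeZero L] in
/-- `|Orb (FermionTorus 2 L)|` bookkeeping: the Fock space of the torus has dimension `2^{2L²}`. [folklore] -/
theorem card_orb_fermionTorus_two : Fintype.card (Orb (FermionTorus 2 L)) = 2 * L ^ 2 := by
  rw [card_orb]
  simp [FermionTorus, Fintype.card_lex]

/-- **BdG partition function of the `d`-wave-sourced free Hubbard torus** (`L ≥ 3`):
`Tr e^{-β dWaveSourceTorus L 0 μ s} = 2^{2L²} Π_k e^{-βξ_k} (1 + cosh(β√(ξ_k² + 8s²ĝ_d(k)²)))/2`,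
`ξ_k = ε_L(k) - μ` — equivalently `Π_k e^{-βξ_k} (2cosh(βE_k/2))²`: each pair `(k↑, -k↓)` contributes
the four Bogoliubov levels `ξ_k, ξ_k, ξ_k ∓ E_k`. [cite: VondelftRalph2001, §4.2] -/
theorem partitionFn_dWaveSourceTorus_zero (hL : 3 ≤ L) (β μ s : ℝ) :
    partitionFn β (dWaveSourceTorus L 0 μ s) =
      (2 : ℂ) ^ Fintype.card (Orb (FermionTorus 2 L)) *
        ∏ k : TorusSite 2 L, ((Real.exp (-(β * (torusBand L k - μ))) *
          ((1 + Real.cosh (β * Real.sqrt ((torusBand L k - μ) ^ 2 +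
            (2 * Real.sqrt 2 * s * dWaveGap k) ^ 2))) / 2) : ℝ) : ℂ) := by
  obtain ⟨W, W', h1, hconj⟩ := exists_conj_onSiteBdG_eq_dWaveSourceTorus hL μ s
  rw [← hconj, partitionFn_conj_of_mul_eq_one h1]
  have key := trace_exp_neg_smul_sum_onSiteBdG (Λ := FermionTorus 2 L)
    (fun x => torusBand L x.toTorusSite - μ) (fun x => 2 * Real.sqrt 2 * s * dWaveGap x.toTorusSite) β
    Finset.univ
  have hprod : ∀ f : TorusSite 2 L → ℂ,
      ∏ x : FermionTorus 2 L, f x.toTorusSite = ∏ k : TorusSite 2 L, f k := fun f =>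
    Fintype.prod_equiv FermionTorus.equivTorusSite _ _ fun _ => rfl
  rw [hprod (fun k => ((Real.exp (-(β * (torusBand L k - μ))) *
          ((1 + Real.cosh (β * Real.sqrt ((torusBand L k - μ) ^ 2 +
            (2 * Real.sqrt 2 * s * dWaveGap k) ^ 2))) / 2) : ℝ) : ℂ))] at key
  rw [partitionFn, gibbsWeight]
  -- generic (`LinearOrder`) vs concrete (`Lex`) `DecidableEq` paths meet here
  convert key using 4

/-- The real, positive per-mode factor `g_k(s) = e^{-βξ_k}(1 + cosh(βE_k(s)))/2`. [folklore] -/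
theorem bdgModeFactor_pos (β ξ D : ℝ) :
    0 < Real.exp (-(β * ξ)) * ((1 + Real.cosh (β * Real.sqrt (ξ ^ 2 + D ^ 2))) / 2) := by
  have := Real.one_le_cosh (β * Real.sqrt (ξ ^ 2 + D ^ 2))
  positivity

/-- The partition function of the sourced free torus as a REAL product. [cite: VondelftRalph2001, §4.2] -/
theorem partitionFn_dWaveSourceTorus_zero_re (hL : 3 ≤ L) (β μ s : ℝ) :
    (partitionFn β (dWaveSourceTorus L 0 μ s)).re =
      (2 : ℝ) ^ Fintype.card (Orb (FermionTorus 2 L)) *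
        ∏ k : TorusSite 2 L, (Real.exp (-(β * (torusBand L k - μ))) *
          ((1 + Real.cosh (β * Real.sqrt ((torusBand L k - μ) ^ 2 +
            (2 * Real.sqrt 2 * s * dWaveGap k) ^ 2))) / 2)) := by
  rw [partitionFn_dWaveSourceTorus_zero hL β μ s, ← Complex.ofReal_prod]
  have h2 : (2 : ℂ) ^ Fintype.card (Orb (FermionTorus 2 L)) = (((2 : ℝ) ^ Fintype.card (Orb (FermionTorus 2 L)) : ℝ) : ℂ) := by
    push_cast; rfl
  rw [h2, ← Complex.ofReal_mul, Complex.ofReal_re]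

/-- **Sourced pressure gain of the free gas** (`L ≥ 3`): the `2^{2L²}` and `e^{-βξ_k}` factors cancel,
`log Tr e^{-βH_L(s)} - log Tr e^{-βH_L(0)} = Σ_k [log((1 + cosh βE_k(s))/2) - log((1 + cosh βξ_k)/2)]`,
`E_k(s) = √(ξ_k² + 8s²ĝ_d(k)²)` (at `s = 0`, `E_k = |ξ_k|` and `cosh` is even). With
`(1 + cosh y)/2 = cosh²(y/2)` this is `2Σ_k [log cosh(βE_k/2) - log cosh(βξ_k/2)]`. [cite: VondelftRalph2001, §4.2] -/
theorem log_partitionFn_dWaveSourceTorus_zero_sub (hL : 3 ≤ L) (β μ s : ℝ) :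
    Real.log (partitionFn β (dWaveSourceTorus L 0 μ s)).re -
        Real.log (partitionFn β (dWaveSourceTorus L 0 μ 0)).re =
      ∑ k : TorusSite 2 L,
        (Real.log ((1 + Real.cosh (β * Real.sqrt ((torusBand L k - μ) ^ 2 +
            (2 * Real.sqrt 2 * s * dWaveGap k) ^ 2))) / 2) -
          Real.log ((1 + Real.cosh (β * (torusBand L k - μ))) / 2)) := by
  rw [partitionFn_dWaveSourceTorus_zero_re hL, partitionFn_dWaveSourceTorus_zero_re hL]
  have hpow : (0 : ℝ) < (2 : ℝ) ^ Fintype.card (Orb (FermionTorus 2 L)) := by positivity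
  have hfac : ∀ (t : ℝ) (k : TorusSite 2 L), Real.exp (-(β * (torusBand L k - μ))) *
      ((1 + Real.cosh (β * Real.sqrt ((torusBand L k - μ) ^ 2 + (2 * Real.sqrt 2 * t * dWaveGap k) ^ 2))) / 2) ≠ 0 :=
    fun t k => (bdgModeFactor_pos β _ _).ne'
  rw [Real.log_mul hpow.ne' (Finset.prod_ne_zero_iff.2 fun k _ => hfac s k),
    Real.log_mul hpow.ne' (Finset.prod_ne_zero_iff.2 fun k _ => hfac 0 k),
    Real.log_prod (s := Finset.univ) (hf := fun k _ => hfac s k), Real.log_prod (s := Finset.univ) (hf := fun k _ => hfac 0 k), add_sub_add_left_eq_sub,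
    ← Finset.sum_sub_distrib]
  refine Finset.sum_congr rfl fun k _ => ?_
  have hcosh : ∀ D : ℝ, 0 < (1 + Real.cosh (β * Real.sqrt ((torusBand L k - μ) ^ 2 + D ^ 2))) / 2 := fun D => by
    have := Real.one_le_cosh (β * Real.sqrt ((torusBand L k - μ) ^ 2 + D ^ 2)); positivity
  rw [Real.log_mul (Real.exp_pos _).ne' (hcosh _).ne', Real.log_mul (Real.exp_pos _).ne' (hcosh _).ne',
    add_sub_add_left_eq_sub]
  congr 2
  rw [mul_zero, zero_mul, zero_pow two_ne_zero, add_zero, Real.sqrt_sq_eq_abs]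
  rcases abs_choice (torusBand L k - μ) with h | h
  · rw [h]
  · rw [h, mul_neg, Real.cosh_neg]

end Literature.MathematicalPhysics.QuantumLattice
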